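import Mathlib.Analysis.Convex.Combination
import Mathlib.Analysis.Matrix.PosDef
import Literature.Analysis.Matrix.KyFanMaximumPrinciple
import Literature.Computability.AlgebraicComplexity.Yab15BRank
import HarnessLib

/-!
# Yabe 2015, §4.1: the concave-minimisation certificate (Lemma 4.1, Theorem 4.5) — proofs

Topic `Literature/Computability/AlgebraicComplexity`; proofs file for two named facts of
`Yab15BRank.lean` (A. Yabe, *Bi-polynomial rank and determinantal complexity*, arXiv:1504.00151,
§4.1, held text `paper:arxiv-1504.00151` p0010):

* `yabe2015_lemma_4_1_holds` — **Lemma 4.1**: for a nonempty family `𝒳` of positive semidefinite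
  real matrices, `minrank(𝒳) > r ⇔ μ_{n−r}(X) > 0` for all `X ∈ 𝒳` (`μ_l` = sum of the `l` smallest
  eigenvalues, `sumSmallestEig`). Pivot (`Yabe.rank_gt_iff_sumSmallestEig_pos`): for a psd `X` with
  decreasingly sorted spectrum `λ₀ ≥ λ₁ ≥ ⋯ ≥ λ_{n−1} ≥ 0` (Mathlib's `eigenvalues₀`), both
  `rank X > r` and `μ_{n−r}(X) > 0` say `λ_r > 0` (`rank X = #{j : λ_j ≠ 0}`,
  `Matrix.IsHermitian.rank_eq_card_non_zero_eigs`).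
* `yabe2015_thm_4_5_holds` — **Theorem 4.5**: if `𝒳 ⊆ conv(𝒴)` with `𝒴 ⊆ Sym_n` and `μ_{n−r} > 0`
  on `𝒴`, then `minrank(𝒳) > r`. As printed the proof quotes the concavity of `μ_l` (Cor. 4.4); here
  the same inequality `μ_l(Σ wᵢ Yᵢ) ≥ Σ wᵢ μ_l(Yᵢ)` comes straight from Ky Fan's minimum principle in
  the tree (`Literature.Analysis.Matrix.KyFan.sum_eigenvalues₀_tail_le_sum_rayleigh` /
  `exists_frame_sum_rayleigh_eq_tail`, `KyFanMaximumPrinciple.lean`): evaluate the orthonormal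
  frame attaining `μ_l(X)` on each `Yᵢ` (`Yabe.sumSmallestEig_pos_of_mem_convexHull`); then Lemma 4.1.

No new definitions, no new facts. Honest framing: bookkeeping of a published linear-algebra
certificate; nothing here bears on `VP ≠ VNP` beyond what Yabe's paper states.

## References

* [Yabe2015] A. Yabe, *Bi-polynomial rank and determinantal complexity*, arXiv:1504.00151 (2015),
  §4.1: Lemma 4.1, Cor. 4.4, Thm. 4.5 (held text p0010).
* [HornJohnson2013] R. A. Horn, C. R. Johnson, *Matrix Analysis*, 2nd ed., Cor. 4.3.39 (Ky Fan).
-/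

noncomputable section

open Matrix Finset

namespace Literature.Computability.AlgebraicComplexity

namespace Yabe

universe v

variable {n : Type v} [Fintype n] [DecidableEq n]

/-! ### `μ_l` unfolded, and Ky Fan's minimum principle for it -/

/-- For a symmetric `Y` and `l ≤ n`, `μ_l(Y)` is the sum of the `l` smallest sorted eigenvalues
(indices `rev 0, …, rev (l−1)` of Mathlib's decreasing `eigenvalues₀`). [cite: Yabe2015, §4.1] -/
theorem sumSmallestEig_eq {Y : Matrix n n ℝ} (hY : Y.IsHermitian) {l : ℕ}
    (hl : l ≤ Fintype.card n) :
    sumSmallestEig Y l = ∑ t : Fin l, hY.eigenvalues₀ (Fin.rev (Fin.castLE hl t)) := by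
  rw [sumSmallestEig, dif_pos ⟨hY, hl⟩]

/-- **Ky Fan's minimum principle for `μ_l`**: `μ_l(Y) ≤ Σ_t hₜᵀ Y hₜ` for every orthonormal
`l`-frame `h` (tree: `KyFan.sum_eigenvalues₀_tail_le_sum_rayleigh`). [cite: HornJohnson2013, Cor. 4.3.39] -/
theorem sumSmallestEig_le_sum_rayleigh {Y : Matrix n n ℝ} (hY : Y.IsHermitian) {l : ℕ}
    (hl : l ≤ Fintype.card n) (h : Fin l → n → ℝ)
    (horth : ∀ t u, h t ⬝ᵥ h u = if t = u then (1 : ℝ) else 0) :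
    sumSmallestEig Y l ≤ ∑ t, h t ⬝ᵥ Y *ᵥ h t := by
  rw [sumSmallestEig_eq hY hl]
  exact Literature.Analysis.Matrix.KyFan.sum_eigenvalues₀_tail_le_sum_rayleigh hY hl h horth

/-- **Attainment**: some orthonormal `l`-frame `h` has `Σ_t hₜᵀ X hₜ = μ_l(X)` (tree:
`KyFan.exists_frame_sum_rayleigh_eq_tail`). [cite: HornJohnson2013, Cor. 4.3.39] -/
theorem exists_frame_sum_rayleigh_eq_sumSmallestEig {X : Matrix n n ℝ} (hX : X.IsHermitian)
    {l : ℕ} (hl : l ≤ Fintype.card n) :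
    ∃ h : Fin l → n → ℝ, (∀ t u, h t ⬝ᵥ h u = if t = u then (1 : ℝ) else 0) ∧
      ∑ t, h t ⬝ᵥ X *ᵥ h t = sumSmallestEig X l := by
  obtain ⟨h, horth, -, hsum⟩ :=
    Literature.Analysis.Matrix.KyFan.exists_frame_sum_rayleigh_eq_tail hX hl
  exact ⟨h, horth, by rw [hsum, sumSmallestEig_eq hX hl]⟩

/-- **Concavity of `μ_l` along convex combinations (Yabe 2015, Cor. 4.4, in the form used by
Thm. 4.5)**: if `X` is symmetric and a convex combination of symmetric matrices `Y ∈ 𝒴` with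
`μ_l(Y) > 0`, then `μ_l(X) > 0` — indeed `μ_l(Σ wᵢ Yᵢ) = Σ_t hₜᵀ(Σ wᵢ Yᵢ)hₜ = Σ wᵢ Σ_t hₜᵀ Yᵢ hₜ
≥ Σ wᵢ μ_l(Yᵢ) > 0` for the frame `h` attaining `μ_l(X)`. [cite: Yabe2015, Corollary 4.4] -/
theorem sumSmallestEig_pos_of_mem_convexHull {𝒴 : Set (Matrix n n ℝ)} (h𝒴 : ∀ Y ∈ 𝒴, Y.IsSymm)
    {l : ℕ} (hl : l ≤ Fintype.card n) (hpos : ∀ Y ∈ 𝒴, 0 < sumSmallestEig Y l)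
    {X : Matrix n n ℝ} (hXh : X.IsHermitian) (hX : X ∈ convexHull ℝ 𝒴) :
    0 < sumSmallestEig X l := by
  obtain ⟨ι, _, w, z, hw0, hw1, hz, hzX⟩ := mem_convexHull_iff_exists_fintype.mp hX
  obtain ⟨h, horth, hsum⟩ := exists_frame_sum_rayleigh_eq_sumSmallestEig hXh hl
  rw [← hsum, ← hzX]
  have hexp : ∑ t, h t ⬝ᵥ (∑ i, w i • z i) *ᵥ h t = ∑ i, w i * ∑ t, h t ⬝ᵥ z i *ᵥ h t := by
    simp_rw [Matrix.sum_mulVec, Matrix.smul_mulVec, dotProduct_sum, dotProduct_smul, smul_eq_mul,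
      Finset.mul_sum]
    exact Finset.sum_comm
  rw [hexp]
  have hge : ∀ i, w i * sumSmallestEig (z i) l ≤ w i * ∑ t, h t ⬝ᵥ z i *ᵥ h t := fun i =>
    mul_le_mul_of_nonneg_left
      (sumSmallestEig_le_sum_rayleigh (Matrix.isHermitian_iff_isSymm.mpr (h𝒴 _ (hz i))) hl h horth)
      (hw0 i)
  obtain ⟨i, hi⟩ : ∃ i, 0 < w i := by
    by_contra hcon
    push Not at hcon
    have h0 : ∑ i, w i ≤ 0 := sum_nonpos fun i _ => hcon i
    linarith
  calc (0 : ℝ) < ∑ i, w i * sumSmallestEig (z i) l :=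
        lt_of_lt_of_le (mul_pos hi (hpos _ (hz i)))
          (single_le_sum (f := fun j => w j * sumSmallestEig (z j) l)
            (fun j _ => mul_nonneg (hw0 j) (hpos _ (hz j)).le) (mem_univ i))
    _ ≤ ∑ i, w i * ∑ t, h t ⬝ᵥ z i *ᵥ h t := sum_le_sum fun i _ => hge i

/-! ### Positive semidefinite matrices: `rank > r ⇔ λ_r > 0 ⇔ μ_{n−r} > 0` -/

/-- The sorted eigenvalues of a positive semidefinite real matrix are nonnegative.
[cite: Yabe2015, §4.1] -/
theorem eigenvalues₀_nonneg {X : Matrix n n ℝ} (hX : X.PosSemidef) (j : Fin (Fintype.card n)) :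
    0 ≤ hX.1.eigenvalues₀ j := by
  have h := Matrix.PosSemidef.eigenvalues_nonneg hX (Fintype.equivOfCardEq (Fintype.card_fin _) j)
  simpa [Matrix.IsHermitian.eigenvalues] using h

/-- The rank of a symmetric real matrix is the number of its nonzero sorted eigenvalues
(Mathlib's `rank_eq_card_non_zero_eigs`, re-indexed to `eigenvalues₀`). [folklore] -/
private theorem rank_eq_card_eigenvalues₀_ne_zero {X : Matrix n n ℝ} (hX : X.IsHermitian) :
    X.rank = (univ.filter fun j : Fin (Fintype.card n) => hX.eigenvalues₀ j ≠ 0).card := by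
  rw [hX.rank_eq_card_non_zero_eigs, Fintype.card_subtype]
  refine card_equiv (Fintype.equivOfCardEq (Fintype.card_fin _)).symm fun i => ?_
  simp only [mem_filter, mem_univ, true_and, Matrix.IsHermitian.eigenvalues]

/-- For a psd `X` with sorted spectrum `λ` and `r < n`: `rank X > r ⇔ λ_r > 0` (the nonzero
eigenvalues of a psd matrix are the largest ones). [cite: Yabe2015, Lemma 4.1] -/
theorem rank_gt_iff_eigenvalues₀_pos {X : Matrix n n ℝ} (hX : X.PosSemidef) {r : ℕ}
    (hr : r < Fintype.card n) : r < X.rank ↔ 0 < hX.1.eigenvalues₀ ⟨r, hr⟩ := by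
  have hanti := hX.1.eigenvalues₀_antitone
  rw [rank_eq_card_eigenvalues₀_ne_zero hX.1]
  constructor
  · intro hlt
    by_contra hle
    push Not at hle
    have hr0 : hX.1.eigenvalues₀ ⟨r, hr⟩ = 0 := le_antisymm hle (eigenvalues₀_nonneg hX _)
    -- every nonzero eigenvalue has index `< r`
    have hsub : (univ.filter fun j : Fin (Fintype.card n) => hX.1.eigenvalues₀ j ≠ 0) ⊆
        univ.filter fun j : Fin (Fintype.card n) => (j : ℕ) < r := by
      intro j hj
      rw [mem_filter] at hj ⊢
      refine ⟨mem_univ _, ?_⟩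
      by_contra hjr
      push Not at hjr
      have hle' : hX.1.eigenvalues₀ j ≤ hX.1.eigenvalues₀ ⟨r, hr⟩ :=
        hanti (Fin.le_iff_val_le_val.mpr (by simpa using hjr))
      exact hj.2 (le_antisymm (hle'.trans hr0.le) (eigenvalues₀_nonneg hX _))
    have hcard : (univ.filter fun j : Fin (Fintype.card n) => (j : ℕ) < r).card = r := by
      rw [Fin.card_filter_val_lt]; omega
    have := (card_le_card hsub).trans_eq hcard
    omega
  · intro hpos
    -- the indices `≤ r` all carry positive eigenvalues
    have hsub : (univ.filter fun j : Fin (Fintype.card n) => (j : ℕ) < r + 1) ⊆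
        univ.filter fun j : Fin (Fintype.card n) => hX.1.eigenvalues₀ j ≠ 0 := by
      intro j hj
      rw [mem_filter] at hj ⊢
      refine ⟨mem_univ _, ne_of_gt (lt_of_lt_of_le hpos (hanti ?_))⟩
      exact Fin.le_iff_val_le_val.mpr (by simpa using Nat.lt_succ_iff.mp hj.2)
    have hcard : (univ.filter fun j : Fin (Fintype.card n) => (j : ℕ) < r + 1).card = r + 1 := by
      rw [Fin.card_filter_val_lt]; omega
    have := hcard.symm.le.trans (card_le_card hsub)
    omega

/-- For a psd `X` with sorted spectrum `λ` and `r < n`: `μ_{n−r}(X) > 0 ⇔ λ_r > 0` (the `n − r`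
smallest eigenvalues are `λ_r ≥ ⋯ ≥ λ_{n−1} ≥ 0`). [cite: Yabe2015, Lemma 4.1] -/
theorem sumSmallestEig_pos_iff_eigenvalues₀_pos {X : Matrix n n ℝ} (hX : X.PosSemidef) {r : ℕ}
    (hr : r < Fintype.card n) :
    0 < sumSmallestEig X (Fintype.card n - r) ↔ 0 < hX.1.eigenvalues₀ ⟨r, hr⟩ := by
  have hanti := hX.1.eigenvalues₀_antitone
  have hl : Fintype.card n - r ≤ Fintype.card n := Nat.sub_le _ _
  rw [sumSmallestEig_eq hX.1 hl]
  constructor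
  · intro hsum
    have hsum' : ∑ _t : Fin (Fintype.card n - r), (0 : ℝ) <
        ∑ t : Fin (Fintype.card n - r), hX.1.eigenvalues₀ (Fin.rev (Fin.castLE hl t)) := by
      rwa [sum_const_zero]
    obtain ⟨t, -, ht⟩ := exists_lt_of_sum_lt hsum'
    refine lt_of_lt_of_le ht (hanti ?_)
    have ht2 := t.2
    rw [Fin.le_iff_val_le_val, Fin.val_rev, Fin.val_castLE]
    dsimp only
    omega
  · intro hpos
    have ht : (Fintype.card n - 1 - r) < Fintype.card n - r := by omega
    refine lt_of_lt_of_le ?_ (single_le_sum (f := fun t : Fin (Fintype.card n - r) =>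
      hX.1.eigenvalues₀ (Fin.rev (Fin.castLE hl t))) (fun t _ => eigenvalues₀_nonneg hX _)
      (mem_univ ⟨Fintype.card n - 1 - r, ht⟩))
    have heq : Fin.rev (Fin.castLE hl ⟨Fintype.card n - 1 - r, ht⟩) = ⟨r, hr⟩ := by
      ext
      simp only [Fin.val_rev, Fin.val_castLE]
      omega
    rw [heq]
    exact hpos

/-- **Pivot of Lemma 4.1**: for a positive semidefinite real `X` and any `r`,
`rank X > r ⇔ μ_{n−r}(X) > 0` (for `r ≥ n` both sides fail: `rank X ≤ n`, `μ_0 = 0`).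
[cite: Yabe2015, Lemma 4.1] -/
theorem rank_gt_iff_sumSmallestEig_pos {X : Matrix n n ℝ} (hX : X.PosSemidef) (r : ℕ) :
    r < X.rank ↔ 0 < sumSmallestEig X (Fintype.card n - r) := by
  by_cases hr : r < Fintype.card n
  · rw [rank_gt_iff_eigenvalues₀_pos hX hr, sumSmallestEig_pos_iff_eigenvalues₀_pos hX hr]
  · push Not at hr
    have h0 : Fintype.card n - r = 0 := Nat.sub_eq_zero_of_le hr
    rw [h0, sumSmallestEig_eq hX.1 (Nat.zero_le _)]
    simp only [univ_eq_empty, sum_empty, lt_self_iff_false, iff_false, not_lt]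
    exact (Matrix.rank_le_card_width X).trans hr

end Yabe

/-! ### The two named facts -/

/-- **Yabe 2015, Lemma 4.1 — PROVED**: for a nonempty `𝒳 ⊆ Psd_n` and `r ∈ ℕ`,
`minrank(𝒳) > r` iff `μ_{n−r}(X) > 0` for all `X ∈ 𝒳`. Discharges `yabe2015_lemma_4_1`.
[cite: Yabe2015, Lemma 4.1] -/
theorem yabe2015_lemma_4_1_holds : yabe2015_lemma_4_1 := by
  intro n _ _ 𝒳 r hne hpsd
  constructor
  · intro hr X hX
    exact (Yabe.rank_gt_iff_sumSmallestEig_pos (hpsd X hX) r).mp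
      (lt_of_lt_of_le hr (Nat.sInf_le ⟨X, hX, rfl⟩))
  · intro hμ
    obtain ⟨X₀, hX₀, hX₀r⟩ := Nat.sInf_mem (hne.image Matrix.rank)
    rw [minRank, ← hX₀r]
    exact (Yabe.rank_gt_iff_sumSmallestEig_pos (hpsd X₀ hX₀) r).mpr (hμ X₀ hX₀)

/-- **Yabe 2015, Theorem 4.5 — PROVED** (the concave-minimisation certificate): if `𝒳 ⊆ Psd_n` is
nonempty, `𝒴 ⊆ Sym_n`, `𝒳 ⊆ conv(𝒴)` and `μ_{n−r}(Y) > 0` for all `Y ∈ 𝒴`, then `minrank(𝒳) > r`.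
Discharges `yabe2015_thm_4_5`. [cite: Yabe2015, Theorem 4.5] -/
theorem yabe2015_thm_4_5_holds : yabe2015_thm_4_5 := by
  intro n _ _ 𝒳 r hne hpsd h
  obtain ⟨𝒴, h𝒴, hsub, hpos⟩ := h
  exact (yabe2015_lemma_4_1_holds n 𝒳 r hne hpsd).mpr fun X hX =>
    Yabe.sumSmallestEig_pos_of_mem_convexHull h𝒴 (Nat.sub_le _ _) hpos (hpsd X hX).1 (hsub hX)

end Literature.Computability.AlgebraicComplexity

end
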